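import Summits.BirchSwinnertonDyer.Rank1Residual.AdditivePotMult.TwistSupplyRam
import Literature.NumberTheory.EllipticCurves.Rank1Residual.Typed.X11
import HarnessLib

/-!
# X4(M): the rank-zero `p`-multiplicative twist as DATA, the all-pairs relocation (over-`K` + X11a),
# and the one-sided form on X4(M) ∧ (ram)

HONEST FRAMING (cell `b2b-bsdres`, run/shared/lean/b2b/bsd-rank1-residual/, verbatim in every
file): the goal of the cell is to DELETE the COMBINATION-SHAPED residual classes of the
Birch–Swinnerton-Dyer formula for ALL analytic-rank `≤ 1` elliptic curves over `ℚ` — "full BSD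
formula for every rank `≤ 1` curve in class `C`" assembled STRICTLY from published theorems — so
that the rank-`≤ 1` remainder becomes exactly the CONSTRUCTION-SHAPED classes, which are TYPED
(missing-input `Prop`s), NOT attempted. This is not "finishing BSD". Sub-cell
`b2b-bsdres-additive-p1` (CLASS-OWNERS row "X3/X4 additive — pot. multiplicative / X3♯(M)"),
generation 3; research route, no claim beyond the stated sub-classes; X4(M) REMAINS
CONSTRUCTION-SHAPED.

Theorems only; no definition, no new named fact. Companion of `TwistSupplyRam.lean`:

* `ClassX4M.exists_rankZero_mult_twist` — for EVERY `(E,p) ∈ X4(M)`: a quadratic field `K` and a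
  globally minimal model `Wd` of `E^{(d_K)}` with `Mult Wd p`, `Irr Wd p`, `r_an(Wd) = 0` (twist supply
  on a `p`-multiplicative twist; Hoffstein–Luo + modularity).
* `ClassX4M.exists_ram_rankZero_mult_twist` — on X4(M) ∧ (ram) the twist may be taken with
  `Ram Wd p` as well (the construction of `bsdp_of_classX4M_of_ram`, returned as data).
* **`bsdp_of_classX4M`** — the COMPLETE relocation of X4(M), uniform over all pairs: for
  `(E,p) ∈ X4(M)` of analytic rank `≤ 1`, `BSD(E,p)` follows from (i) the over-`K` input over the
  quadratic fields whose twist is `p`-multiplicative and (ii) the cell's typed rank-zero X11 input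
  `X11RankZero.MissingInputAt` for the globally minimal curves `V` with `r_an(V) = 0` in class X11 at
  `p` (x11a's CONSTRUCTION-SHAPED input; needed only when the produced twist fails (ram) — on
  X4(M) ∧ (ram) it is dispensable, `bsdp_of_classX4M_of_ram`), with Skinner 2016 Thm. C, Wuthrich
  2014 Prop. 21, Milne 1972 any-model, GZK, modularity, Hoffstein–Luo 1997 as binders.
* **`bsdp_of_classX4M_of_ram_of_lowerOverC_of_kim`** — X4(M) ∧ (ram) ∧ {`r_an(E) = 0`, `p ≥ 5`,
  `ρ̄_{E,p}` onto, `p ∤ c_D · ∏ c_ℓ(E)`}: `BSD(E,p)` from ONE inequality over the quadratic fields,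
  `MissingLowerBoundOverCAt (W.baseChange K) p` (`ord_p #Ш_an(E_K) ≤ ord_p #Ш(E_K)`), uniformly — the
  upper half being Kim 2026 Thm. 1.8 (6) over `ℚ` (gen 2's `bsdp_of_classX4M_of_lowerOverC_of_kim`).

Census (REPORT §7; `N < 2·10⁴ ‖ 10⁴`): X4(M) = 1754 ‖ 418; X4(M) ∧ (ram) = 1673 ‖ 398 (kernel,
`bsdp_of_classX4M_of_ram`); the rest = 10 ‖ 0 (only additive (ram)-capable primes) + 71 ‖ 20 (no
(ram)-capable prime) — covered by `bsdp_of_classX4M` at the price of the X11 input.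
-/

noncomputable section

open scoped Classical

open WeierstrassCurve Literature.NumberTheory.EllipticCurves
  Literature.NumberTheory.EllipticCurves.ModularForms
  Literature.NumberTheory.EllipticCurves.Rank1Residual
  Literature.NumberTheory.EllipticCurves.Rank1Residual.Typed
  Literature.NumberTheory.EllipticCurves.Wuthrich2014
  IsDedekindDomain

namespace Summit.BirchSwinnertonDyer.Rank1Residual.AdditivePotMult

variable {W : WeierstrassCurve ℚ} [W.IsElliptic] {p : ℕ} [Fact p.Prime]

/-! ### §1 The rank-zero `p`-multiplicative twist of an X4(M) pair, as data -/

/-- **From a `p`-multiplicative twist to a rank-zero `p`-multiplicative twist over a quadratic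
field** (the common core): given `(E,p)` with `E` NOT multiplicative at `p`, `p` odd, a globally
minimal model `W₁` of some `E^{(d₀)}` which is multiplicative at `p`, and a finite set `Q` of naturals,
there are a quadratic field `K` and a globally minimal model `Wd` of `E^{(d_K)}` with `Mult Wd p`,
`r_an(Wd) = 0`, and, at every prime `q ∈ Q`, `q ≠ p`: multiplicative reduction transports from `W₁` to
`Wd` and `v_q(Δ_min(Wd)) = v_q(Δ_min(W₁))` (twist supply split at `Q`, `exists_twist_L_ne_zero_of_sign`;
transport along the `q`-adic square `n`, x11b's lemmas). [folklore] -/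
theorem exists_rankZero_mult_twist_of_mult_twist [W.IsGloballyMinimal]
    (hnf : exists_isNewformOf) (hHL : HoffsteinLuo1997_exists_twist_L_one_ne_zero)
    (hp2 : p ≠ 2) (hW : ¬ Mult W p)
    {d₀ : ℚ} (hd₀ : d₀ ≠ 0) (W₁ : WeierstrassCurve ℚ) [W₁.IsElliptic] [W₁.IsGloballyMinimal]
    (hW₁ : ∃ C : VariableChange ℚ, C • W.quadraticTwist d₀ = W₁) (hmult₁ : Mult W₁ p)
    (Q : Finset ℕ) :
    ∃ (K : Type) (_ : Field K) (_ : NumberField K) (Wd : WeierstrassCurve ℚ) (_ : Wd.IsElliptic)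
      (_ : Wd.IsGloballyMinimal), Module.finrank ℚ K = 2 ∧
      (∃ C : VariableChange ℚ, C • W.quadraticTwist (NumberField.discr K : ℚ) = Wd) ∧
      Mult Wd p ∧ Wd.analyticRank = 0 ∧
      ∀ (q : ℕ) [Fact q.Prime], q ∈ Q → q ≠ p → (Mult W₁ q → Mult Wd q) ∧
        padicValInt q Wd.minimalDiscriminantInt = padicValInt q W₁.minimalDiscriminantInt := by
  have hp : p.Prime := Fact.out
  have hpN : p ∣ W₁.conductorNorm ℤ := dvd_conductorNorm_of_mult W₁ hmult₁
  have hpN2 : ¬ p ^ 2 ∣ W₁.conductorNorm ℤ := not_sq_dvd_conductorNorm_of_mult' W₁ hmult₁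
  obtain ⟨n, -, hn8, -, hnsign, hpn, hjac, hL⟩ :=
    exists_twist_L_ne_zero_of_sign hnf hHL W₁ hp hp2 hpN hpN2 Q (s := 1) (Or.inl rfl) 0
  have hn0 : 0 < n := Int.sign_eq_one_iff_pos.mp hnsign
  have hnQ : ((n : ℤ) : ℚ) ≠ 0 := by exact_mod_cast hn0.ne'
  haveI := W₁.isElliptic_quadraticTwist hnQ
  obtain ⟨Wd, iWd, iWdm, C₂, hC₂⟩ := exists_globallyMinimal_model_twist W₁ hnQ
  have hC₂' : C₂⁻¹ • Wd = W₁.quadraticTwist ((n : ℤ) : ℚ) := by rw [← hC₂, inv_smul_smul]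
  have hmultd : Mult Wd p :=
    X2.hasMultiplicativeReductionAtPrime_of_smul_eq_quadraticTwist W₁ Wd hC₂' p hp2 hpn hmult₁
  have hr0 : Wd.analyticRank = 0 := by
    rw [← hC₂, analyticRank_smul]
    exact analyticRank_eq_zero_of_entireLFunction_one_ne_zero _ hL
  -- the field
  obtain ⟨C₁, hC₁⟩ := hW₁
  have hmodel : ∃ C : VariableChange ℚ, C • W.quadraticTwist (d₀ * ((n : ℤ) : ℚ)) = Wd := by
    refine ⟨C₂ * ⟨C₁.u, ((n : ℤ) : ℚ) * C₁.r, 0, 0⟩, ?_⟩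
    rw [mul_smul, ← quadraticTwist_quadraticTwist, ← quadraticTwist_smul, hC₁, hC₂]
  have hne : ¬ ∃ C : VariableChange ℚ, C • W = Wd := by
    rintro ⟨C, hC⟩
    apply hW
    rw [← hC] at hmultd
    exact (hasMultiplicativeReductionAtPrime_smul_iff W C p).mp hmultd
  obtain ⟨K, iF, iN, h2, hWd⟩ := exists_quadraticField_model W (mul_ne_zero hd₀ hnQ) hmodel hne
  refine ⟨K, iF, iN, Wd, iWd, iWdm, h2, hWd, hmultd, hr0, fun q _ hq hqp ↦ ?_⟩
  -- transport at a prime `q ∈ Q`, `q ≠ p`, along the `q`-adic square `n`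
  have hqP : q.Prime := Fact.out
  have hnsq : IsSquare ((((n : ℤ) : ℚ) : ℚ) : ℚ_[q]) := by
    by_cases hq2 : q = 2
    · have h := Literature.NumberTheory.QuadraticForms.padic_isSquare_intCast_of_mod_eight
        (p := q) hq2 hn8
      simpa using h
    · have hnq : jacobiSym n q = 1 := hjac q hq hqP hq2 hqp
      have h := padic_isSquare_of_jacobiSym_eq_one hq2 hnq
      simpa using h
  exact ⟨fun hmq ↦ (X11b.mult_iff_of_twist W₁ hnQ hnsq Wd hC₂).mpr hmq,
    X11b.padicValInt_minimalDiscriminantInt_eq_of_twist W₁ hnQ hnsq Wd hC₂⟩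

/-- **For `(E,p) ∈ X4(M)` a rank-zero `p`-multiplicative twist over a quadratic field EXISTS**
(every pair; no (ram) asked): a quadratic field `K` and a globally minimal model `Wd` of `E^{(d_K)}`
with `Mult Wd p`, `Irr Wd p`, `r_an(Wd) = 0` — assuming modularity (`hnf`) and Hoffstein–Luo 1997
(`hHL`). [folklore] -/
theorem ClassX4M.exists_rankZero_mult_twist [W.IsGloballyMinimal] (hX : ClassX4M W p)
    (hnf : exists_isNewformOf) (hHL : HoffsteinLuo1997_exists_twist_L_one_ne_zero) :
    ∃ (K : Type) (_ : Field K) (_ : NumberField K) (Wd : WeierstrassCurve ℚ) (_ : Wd.IsElliptic)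
      (_ : Wd.IsGloballyMinimal), Module.finrank ℚ K = 2 ∧
      (∃ C : VariableChange ℚ, C • W.quadraticTwist (NumberField.discr K : ℚ) = Wd) ∧
      Mult Wd p ∧ Irr Wd p ∧ Wd.analyticRank = 0 := by
  have hp2 : p ≠ 2 := hX.p_ne_two
  obtain ⟨d, hd0, hmultd⟩ := PotMult.exists_twist_mult (W := W) (p := p) hX.potMult
  obtain ⟨W₁, iW₁, iW₁m, C₁, hC₁⟩ := exists_globallyMinimal_model_twist W hd0
  have hmult₁ : Mult W₁ p := mult_of_model_twist hd0 hmultd ⟨C₁, hC₁⟩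
  obtain ⟨K, iF, iN, Wd, iWd, iWdm, h2, hWd, hmult, hr0, -⟩ :=
    exists_rankZero_mult_twist_of_mult_twist hnf hHL hp2 hX.potMult.not_mult hd0 W₁ ⟨C₁, hC₁⟩
      hmult₁ ∅
  have hD : (NumberField.discr K : ℚ) ≠ 0 := by exact_mod_cast NumberField.discr_ne_zero K
  exact ⟨K, iF, iN, Wd, iWd, iWdm, h2, hWd, hmult, (irr_iff_of_model_twist hD hWd).mpr hX.irr, hr0⟩

/-- **On X4(M) ∧ (ram) the rank-zero `p`-multiplicative twist may be taken with (ram)** (the data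
behind `bsdp_of_classX4M_of_ram`): a quadratic field `K` and a globally minimal model `Wd` of
`E^{(d_K)}` with `Mult Wd p`, `Irr Wd p`, `Ram Wd p`, `r_an(Wd) = 0`. [folklore] -/
theorem ClassX4M.exists_ram_rankZero_mult_twist [W.IsGloballyMinimal] (hX : ClassX4M W p)
    (hram : Ram W p) (hnf : exists_isNewformOf)
    (hHL : HoffsteinLuo1997_exists_twist_L_one_ne_zero) :
    ∃ (K : Type) (_ : Field K) (_ : NumberField K) (Wd : WeierstrassCurve ℚ) (_ : Wd.IsElliptic)
      (_ : Wd.IsGloballyMinimal), Module.finrank ℚ K = 2 ∧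
      (∃ C : VariableChange ℚ, C • W.quadraticTwist (NumberField.discr K : ℚ) = Wd) ∧
      Mult Wd p ∧ Irr Wd p ∧ Ram Wd p ∧ Wd.analyticRank = 0 := by
  have hp : p.Prime := Fact.out
  have hp2 : p ≠ 2 := hX.p_ne_two
  obtain ⟨q, iq, hqp, hmultq, hvq⟩ := hram
  have hq : q.Prime := Fact.out
  -- a `p`-multiplicative twist with square-free integral parameter `m`, adjusted at `q`
  obtain ⟨d, hd0, hmultd⟩ := PotMult.exists_twist_mult (W := W) (p := p) hX.potMult
  obtain ⟨c, m, hc, hm, hdm⟩ := Rat.exists_sq_mul_squarefree hd0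
  have hm0 : m ≠ 0 := by
    rintro rfl
    apply hd0
    rw [hdm]; simp
  have hmQ : (m : ℚ) ≠ 0 := by exact_mod_cast hm0
  obtain ⟨W₀, iW₀, iW₀m, C₀, hC₀⟩ := exists_globallyMinimal_model_twist W hmQ
  have hmult₀ : Mult W₀ p := by
    obtain ⟨C₅, hC₅⟩ := W.exists_variableChange_quadraticTwist_mul_sq (m : ℚ) c hc
    have hWd : (C₀ * C₅⁻¹) • W.quadraticTwist d = W₀ := by
      rw [hdm, mul_comm, ← hC₅, mul_smul, inv_smul_smul, hC₀]
    exact mult_of_model_twist hd0 hmultd ⟨C₀ * C₅⁻¹, hWd⟩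
  obtain ⟨x, hx0, hpx, hsq⟩ := exists_mul_isSquare_padic_not_dvd hm0 hm (q := q) hp (Ne.symm hqp)
  have hxQ : ((x : ℤ) : ℚ) ≠ 0 := by exact_mod_cast hx0
  haveI := W₀.isElliptic_quadraticTwist hxQ
  obtain ⟨W₁, iW₁, iW₁m, C₁, hC₁⟩ := exists_globallyMinimal_model_twist W₀ hxQ
  have hC₁' : C₁⁻¹ • W₁ = W₀.quadraticTwist ((x : ℤ) : ℚ) := by rw [← hC₁, inv_smul_smul]
  have hmult₁ : Mult W₁ p :=
    X2.hasMultiplicativeReductionAtPrime_of_smul_eq_quadraticTwist W₀ W₁ hC₁' p hp2 hpx hmult₀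
  have hmx0 : ((m * x : ℤ) : ℚ) ≠ 0 := by exact_mod_cast mul_ne_zero hm0 hx0
  have hW₁ : ∃ C : VariableChange ℚ, C • W.quadraticTwist ((m * x : ℤ) : ℚ) = W₁ := by
    refine ⟨C₁ * ⟨C₀.u, ((x : ℤ) : ℚ) * C₀.r, 0, 0⟩, ?_⟩
    rw [Int.cast_mul, mul_smul, ← quadraticTwist_quadraticTwist, ← quadraticTwist_smul, hC₀, hC₁]
  obtain ⟨C, hC⟩ := hW₁
  have hmultq₁ : Mult W₁ q := (X11b.mult_iff_of_twist W hmx0 hsq W₁ hC).mpr hmultq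
  have hvq₁ : padicValInt q W₁.minimalDiscriminantInt = padicValInt q W.minimalDiscriminantInt :=
    X11b.padicValInt_minimalDiscriminantInt_eq_of_twist W hmx0 hsq W₁ hC
  -- the rank-zero twist, split at `q`
  obtain ⟨K, iF, iN, Wd, iWd, iWdm, h2, hWd, hmult, hr0, hQ⟩ :=
    exists_rankZero_mult_twist_of_mult_twist hnf hHL hp2 hX.potMult.not_mult hmx0 W₁ ⟨C, hC⟩ hmult₁
      {q}
  obtain ⟨hmultdq, hvdq⟩ := hQ q (Finset.mem_singleton_self q) hqp
  have hD : (NumberField.discr K : ℚ) ≠ 0 := by exact_mod_cast NumberField.discr_ne_zero K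
  refine ⟨K, iF, iN, Wd, iWd, iWdm, h2, hWd, hmult, (irr_iff_of_model_twist hD hWd).mpr hX.irr,
    ⟨q, iq, hqp, hmultdq hmultq₁, ?_⟩, hr0⟩
  rw [hvdq, hvq₁]; exact hvq

/-! ### §2 The complete relocation of X4(M): over-`K` input + X11a rank-zero input -/

/-- **X4(M), ALL pairs: `BSD(E,p)` ⇐ over-`K` input over quadratic fields + the typed rank-zero X11
input for the `p`-multiplicative curves.** Let `(E,p) ∈ X4(M)` (`W` globally minimal) have analytic
rank `≤ 1`. Assume (i) `MissingPPartOverCAt (W.baseChange K) p` for every quadratic field `K` whose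
twist `E^{(d_K)}` is multiplicative at `p`, and (ii) the cell's typed input
`X11RankZero.MissingInputAt V p` for every globally minimal `V/ℚ` of analytic rank `0` in class X11 at
`p` (x11a's CONSTRUCTION-SHAPED input: the (ram)-free lower bound at a multiplicative prime). Then
`BSD(E,p)`: the rank-zero `p`-multiplicative irreducible twist `Wd` of
`ClassX4M.exists_rankZero_mult_twist` is closed by Skinner 2016 Thm. C (`hSk`) if `Ram Wd p`, and by
(ii) with Wuthrich 2014 Prop. 21 (`hW`) otherwise (`X11RankZero.bsdp_of_missingInputAt`); the
descent is gen 2's `bsdp_of_pPartOverC_baseChange` (Milne any-model `hMilneC`, GZK, modularity).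
On X4(M) ∧ (ram) hypothesis (ii) is not needed (`bsdp_of_classX4M_of_ram`); it is the price of the
census complement (71 ‖ 20 pairs with no (ram)-capable prime, 10 ‖ 0 with only additive ones).
X4(M) stays CONSTRUCTION-SHAPED. [folklore] -/
theorem bsdp_of_classX4M [W.IsGloballyMinimal]
    (hGZK : rank_eq_analyticRank_of_analyticRank_le_one) (hmod : hasEntireLFunction_rat)
    (hMilneC : Milne1972.bsdQuotient_baseChange_quadratic_anyModel)
    (hSk : Skinner2016.thmC_padicValRat_bsd_rank_zero) (hW : sha_dvd_analyticSha)
    (hnf : exists_isNewformOf) (hHL : HoffsteinLuo1997_exists_twist_L_one_ne_zero)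
    (hX : ClassX4M W p) (hr : W.analyticRank ≤ 1)
    (hK : ∀ (K : Type) [Field K] [NumberField K] (Wd : WeierstrassCurve ℚ) [Wd.IsElliptic]
      [Wd.IsGloballyMinimal], Module.finrank ℚ K = 2 →
      (∃ C : VariableChange ℚ, C • W.quadraticTwist (NumberField.discr K : ℚ) = Wd) →
      Mult Wd p → MissingPPartOverCAt (W.baseChange K) p)
    (hX11 : ∀ (V : WeierstrassCurve ℚ) [V.IsElliptic] [V.IsGloballyMinimal],
      V.analyticRank = 0 → ClassX11 V p → X11RankZero.MissingInputAt V p) :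
    BSDp W p := by
  have hp2 : p ≠ 2 := hX.p_ne_two
  obtain ⟨K, iF, iN, Wd, iWd, iWdm, h2, hWd, hmult, hirr, hr0⟩ := hX.exists_rankZero_mult_twist hnf hHL
  by_cases hram : Ram Wd p
  · exact bsdp_of_classX4M_of_rankZero_twist' W p K Wd hGZK hmod hMilneC hSk hX hr h2 hWd hmult hram
      hr0 (hK K Wd h2 hWd hmult)
  · have hX11d : ClassX11 Wd p := ⟨hmult, hirr, Or.inl hram⟩
    have hd : BSDp Wd p :=
      X11RankZero.bsdp_of_missingInputAt hW hGZK hmod Wd p hp2 hr0 hX11d (hX11 Wd hr0 hX11d)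
    exact bsdp_of_pPartOverC_baseChange W p K Wd hGZK hmod hMilneC hr h2 hWd
      (by rw [hr0]; exact zero_le_one) (hK K Wd h2 hWd hmult) hd

/-- The all-pairs X4(M) relocation in the cell's `MissingPPartAt` currency. [folklore] -/
theorem missingPPartAt_of_classX4M [W.IsGloballyMinimal]
    (hGZK : rank_eq_analyticRank_of_analyticRank_le_one) (hmod : hasEntireLFunction_rat)
    (hMilneC : Milne1972.bsdQuotient_baseChange_quadratic_anyModel)
    (hSk : Skinner2016.thmC_padicValRat_bsd_rank_zero) (hW : sha_dvd_analyticSha)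
    (hnf : exists_isNewformOf) (hHL : HoffsteinLuo1997_exists_twist_L_one_ne_zero)
    (hX : ClassX4M W p) (hr : W.analyticRank ≤ 1)
    (hK : ∀ (K : Type) [Field K] [NumberField K] (Wd : WeierstrassCurve ℚ) [Wd.IsElliptic]
      [Wd.IsGloballyMinimal], Module.finrank ℚ K = 2 →
      (∃ C : VariableChange ℚ, C • W.quadraticTwist (NumberField.discr K : ℚ) = Wd) →
      Mult Wd p → MissingPPartOverCAt (W.baseChange K) p)
    (hX11 : ∀ (V : WeierstrassCurve ℚ) [V.IsElliptic] [V.IsGloballyMinimal],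
      V.analyticRank = 0 → ClassX11 V p → X11RankZero.MissingInputAt V p) :
    MissingPPartAt W p := by
  haveI : Finite W.sha := (hGZK W hr).2
  exact missingPPartAt_of_bsdp W p (bsdp_of_classX4M hGZK hmod hMilneC hSk hW hnf hHL hX hr hK hX11)

/-! ### §3 X4(M) ∧ (ram), rank zero, `p ≥ 5`, `ρ̄` onto, Manin: ONE inequality over the quadratic fields -/

/-- **X4(M) ∧ (ram) ∩ {`r_an(E) = 0`, `p ≥ 5`, `ρ̄_{E,p}` onto, `p ∤ c_D`, `p ∤ ∏ c_ℓ(E)`}: `BSD(E,p)`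
from ONE inequality over the quadratic fields, uniformly.** If `MissingLowerBoundOverCAt
(W.baseChange K) p` (`ord_p #Ш_an(E_K/K) ≤ ord_p #Ш(E_K/K)` on the base-changed model) holds for every
quadratic field `K` whose twist `E^{(d_K)}` is multiplicative at `p`, then `BSD(E,p)` — the upper
half over `ℚ` being Kim 2026 Thm. 1.8 (6) (`hKim`, via additive-p4's `X4RankZero`), the twist pair
produced by `ClassX4M.exists_ram_rankZero_mult_twist` and closed by Skinner 2016 Thm. C (`hSk`);
gen 2's `bsdp_of_classX4M_of_lowerOverC_of_kim`. [folklore] -/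
theorem bsdp_of_classX4M_of_ram_of_lowerOverC_of_kim [W.IsGloballyMinimal]
    (hKim : Kim2026.rankZero_padicValNat_sha_le_of_maninConstant)
    (hGZK : rank_eq_analyticRank_of_analyticRank_le_one) (hmod : hasEntireLFunction_rat)
    (hMilneC : Milne1972.bsdQuotient_baseChange_quadratic_anyModel)
    (hSk : Skinner2016.thmC_padicValRat_bsd_rank_zero)
    (hnf : exists_isNewformOf) (hHL : HoffsteinLuo1997_exists_twist_L_one_ne_zero)
    (hX : ClassX4M W p) (hram : Ram W p) (hp5 : 5 ≤ p) (hrW : W.analyticRank = 0)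
    (hsurj : Surj W p) {N : ℕ} [NeZero N] (D : ModularParametrizationData W N)
    (hc : ¬ (p : ℤ) ∣ D.maninConstant) (htam : ¬ p ∣ W.tamagawaProduct)
    (hK : ∀ (K : Type) [Field K] [NumberField K] (Wd : WeierstrassCurve ℚ) [Wd.IsElliptic]
      [Wd.IsGloballyMinimal], Module.finrank ℚ K = 2 →
      (∃ C : VariableChange ℚ, C • W.quadraticTwist (NumberField.discr K : ℚ) = Wd) →
      Mult Wd p → MissingLowerBoundOverCAt (W.baseChange K) p) :
    BSDp W p := by
  obtain ⟨K, iF, iN, Wd, iWd, iWdm, h2, hWd, hmult, -, hramd, hr0⟩ :=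
    hX.exists_ram_rankZero_mult_twist hram hnf hHL
  exact bsdp_of_classX4M_of_lowerOverC_of_kim W p K Wd hKim hGZK hmod hMilneC hSk hX hp5 hrW hsurj D hc
    htam h2 hWd hmult hramd hr0 (hK K Wd h2 hWd hmult)

end Summit.BirchSwinnertonDyer.Rank1Residual.AdditivePotMult

end
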